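import Summits.BirchSwinnertonDyer.Rank1Residual.Additive.PadicLogImage
import Summits.BirchSwinnertonDyer.Rank1Residual.GaloisImage.LocalTorsionExponentAdditiveThree
import HarnessLib

/-!
# The POINTS SIDE of LEMMA SAT₀ / Lemma L at `ℚ₃` for the fine Kato package (C1) of crux
# `KimAtThreeKolyvagin.KatoKuriharaPortThreeShared` (stmt-BirchSwinnertonDyer-19560): the images of
# `E₁(ℚ₃)` and `E₀(ℚ₃)` under the `3`-adic logarithm and the injectivity of
# `E₀(ℚ₃)/E₁(ℚ₃) → ℤ₃/3ℤ₃` at `t = 0` (cell `bsd-addord`, seat kim3 gen 12; `--supports 19560`)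

HONEST FRAMING. Route W2 (`route-BirchSwinnertonDyer-KimAtThreeKolyvagin`): the crux 19560 rests on
the residual ⟨C1⟩ `KatoFinePackageThree` alone (w2-c3 g5 p471554), whose clauses (C1.b)/(C1.c) are
the (P-EXP) rider `KatoExpStarFiniteLevelAt` — provable for Kato's witnesses from Lemma L and LEMMA
SAT₀ (kim3 memo KIM3-W2-C1-g11 §2.2/§2.4) ONCE the Bloch–Kato dual exponential exists in the tree
(definition item `defn-BlochKatoDualExponential`).  This file proves NOW the part of those two lemmas
that lives on the POINTS of `E(ℚ₃)` and needs no `exp*` (sizing memo KIM3-W2-C1-SIZING-g12 §1,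
items (E-K4) and (δ)), on top of cell `b2b-bsdres` team n1011's `Additive/PadicLogImage`
(`padicLog`, `log(E(ℚ_p)) = p^{t − v_p c_p}ℤ_p`) and `GaloisImage/LocalTorsionExponentAdditiveThree`
(`E₁(ℚ₃)[3] = 0`, `3 • E₀ ⊆ E₁`).  TOOL theorems only (no definition, no named fact, no `sorry`);
closes nothing by itself; nothing booked.

For an elliptic curve `X/ℚ_p` with `ℤ_p`-integral equation, `log = LocalLog.padicLog X : E(ℚ_p) →+ ℚ_p`
(the `ℤ_p`-linear extension of the limit logarithm, = `log_ω` for the invariant differential of the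
equation), `E₁ = X.formalFiltration 0` (the kernel of reduction), `E⁽²⁾ = X.formalFiltration 2`,
`E₀ = X.goodReductionSubgroup ℤ_[p]`:

* §1 (any `p`): `p • E₁ ⊆ E⁽²⁾` (`p_nsmul_mem_formalFiltration_two`) and **`‖log P‖ ≤ p⁻¹` on `E₁`**
  (`norm_padicLog_le_inv_of_mem`) — Silverman *AEC* IV.3.2(a) at the points, via the tree's
  `‖z(jP) − j z(P)‖ ≤ ‖z(P)‖²` and `‖L(Q)‖ = ‖z(Q)‖` on `E⁽²⁾`.
* §2 (`p = 3`, stated for `p` with `hp : p = 3` so that consumers keep `p := 3` symbolic):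
  **`E₁(ℚ₃)` is torsion-free** (`eq_zero_of_mem_formalFiltration_zero_of_isOfFinAddOrder`, from
  `E₁(ℚ₃)[3] = 0` and `E⁽²⁾ ≅ 9ℤ₃`); **`log(E₁(ℚ₃)) = 3ℤ₃` EXACTLY**
  (`exists_mem_formalFiltration_zero_padicLog_eq`, `map_padicLog_formalFiltration_zero`: every `y`
  with `‖y‖ ≤ 3⁻¹` is `log P` for some `P ∈ E₁(ℚ₃)` — the point with parameter `z = 3` has
  `‖log‖ = 3⁻¹` exactly, and the rest is `E⁽²⁾ ≅ 9ℤ₃`); i.e. Lemma L (i)'s `log_ω E₁(ℚ₃) = 3ℤ₃`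
  (AEC IV.6.4(b): `Ê(3ℤ₃) ≅ 3ℤ₃`, here WITHOUT the height-one form of `[3]`, by the index-free
  "one point of exact norm" argument).
* §3 (ADDITIVE reduction): **`log(E₀(ℚ_p)) = log(E(ℚ_p))` when `p ∤ c_p`**
  (`map_padicLog_goodReductionSubgroup_eq_range`, any `p`: `c_p • E ⊆ E₀` and `log(E)` is a
  `ℤ_p`-module); **`log(E(ℚ_p)) = ℤ_p` when moreover `E(ℚ_p)[p] = 0`**
  (`range_padicLog_eq_span_one`, n1011's range theorem at `t = 0`); and the (δ) step of SAT₀ at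
  `p = 3`, `t = 0`: **`P ∈ E₀(ℚ₃)` with `‖log P‖ ≤ 3⁻¹` lies in `E₁(ℚ₃)`**
  (`mem_formalFiltration_zero_of_norm_padicLog_le`) — the injectivity of
  `λ_{ℚ₃} : E₀(ℚ₃)/E₁(ℚ₃) → ℤ₃/3ℤ₃` of KIM3-W2-C1-g11 §2.4 (δ), using `3 • E₀ ⊆ E₁` (cusp) and §2.

What is NOT here: anything about `exp*`, `H¹`, or unramified extensions `K/ℚ₃` (the Galois side and
the `K_w`-port are the sizing memo's other items); no claim on any curve class.

References: J. H. Silverman, *AEC* 2nd ed. (2009) IV.3.2, IV.6.4, VII.2.1–2.2, VII.6.3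
[SilvermanAEC2009]; C.-H. Kim, AJM 148 (2026) §3.2.3, Lemma 3.10/3.11 [Kim2022StructureSelmer];
kim3 memos HOME/kim3/KIM3-W2-C1-g11.md §2.2/§2.4, KIM3-W2-C1-SIZING-g12.md §1–§3.
-/

noncomputable section

-- the cell's Theorems namespace `Summit.BirchSwinnertonDyer.BirchSwinnertonDyer.…` repeats the summit name by design (D-0017)
set_option linter.dupNamespace false

open scoped Classical

namespace Summit.BirchSwinnertonDyer.BirchSwinnertonDyer.Theorems.KimAtThreeFineKatoSATPoints

open WeierstrassCurve IsLocalRing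
open Summit.BirchSwinnertonDyer.Rank1Residual.Additive.LocalLog
open Summit.BirchSwinnertonDyer.Rank1Residual.GaloisImage

variable {p : ℕ} [Fact p.Prime]

/-! ## §1 `p • E₁ ⊆ E⁽²⁾` and `‖log‖ ≤ p⁻¹` on `E₁` (any `p`) -/

section General

variable (X : WeierstrassCurve ℚ_[p]) [X.IsIntegral ℤ_[p]] [X.IsElliptic]

/-- **`p • E₁(ℚ_p) ⊆ E⁽²⁾(ℚ_p)`**: for `P` in the kernel of reduction (`‖z(P)‖ ≤ p⁻¹`),
`‖z(pP)‖ ≤ max(‖z(pP) − p z(P)‖, ‖p z(P)‖) ≤ p⁻²`. [cite: SilvermanAEC2009, IV.3.2(a) with VII.2.2] -/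
theorem p_nsmul_mem_formalFiltration_two {P : X.toAffine.Point} (hP : P ∈ X.formalFiltration 0) :
    p • P ∈ X.formalFiltration 2 := by
  have hP1 : P ∈ X.formalFiltration 1 := by rw [X.formalFiltration_one_eq_zero]; exact hP
  obtain ⟨hker, hz⟩ := (X.mem_formalFiltration_iff).mp hP1
  rw [pow_one] at hz
  refine (X.mem_formalFiltration_iff).mpr ⟨X.isInReductionKernel_nsmul hker p, ?_⟩
  have hp0 : (0 : ℝ) ≤ (p : ℝ)⁻¹ := inv_nonneg.mpr (Nat.cast_nonneg p)
  have h1 := X.norm_formalParameter_nsmul_sub_le hker p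
  have hsplit : X.formalParameter (p • P) =
      (X.formalParameter (p • P) - (p : ℚ_[p]) * X.formalParameter P) +
        (p : ℚ_[p]) * X.formalParameter P := by ring
  rw [hsplit]
  refine (Padic.nonarchimedean _ _).trans (max_le (h1.trans ?_) ?_)
  · rw [pow_two, pow_two]
    exact mul_le_mul hz hz (norm_nonneg _) hp0
  · rw [norm_mul, Padic.norm_p, pow_two]
    exact mul_le_mul_of_nonneg_left hz hp0

/-- **`‖log P‖ ≤ p⁻¹` for `P ∈ E₁(ℚ_p)`** (`p · log P = log(pP) = L(pP)` has norm `‖z(pP)‖ ≤ p⁻²`).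
[cite: SilvermanAEC2009, IV.6.4(b) with VII.2.2] -/
theorem norm_padicLog_le_inv_of_mem {P : X.toAffine.Point} (hP : P ∈ X.formalFiltration 0) :
    ‖padicLog X P‖ ≤ (p : ℝ)⁻¹ := by
  have h2 := p_nsmul_mem_formalFiltration_two X hP
  have hlog : padicLog X (p • P) = X.padicLimitLog (p • P) := padicLog_apply_of_mem X h2
  have hnorm : ‖X.padicLimitLog (p • P)‖ ≤ ((p : ℝ)⁻¹) ^ 2 := by
    rw [X.norm_padicLimitLog_of_mem le_rfl h2]; exact h2.2
  rw [map_nsmul, nsmul_eq_mul] at hlog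
  have hmul : ‖(p : ℚ_[p]) * padicLog X P‖ ≤ (p : ℝ)⁻¹ * (p : ℝ)⁻¹ := by
    rw [hlog, ← pow_two]; exact hnorm
  rw [norm_mul, Padic.norm_p] at hmul
  have hp0 : (0 : ℝ) < p := by exact_mod_cast (Fact.out : p.Prime).pos
  exact le_of_mul_le_mul_left hmul (inv_pos.mpr hp0)

/-- Every value of norm `≤ p⁻²` is the limit logarithm — hence the logarithm — of a point of
`E⁽²⁾(ℚ_p) ⊆ E₁(ℚ_p)` (the tree's `exists_mem_padicLimitLog_eq`). [cite: SilvermanAEC2009, IV.6.4(b) and VII.6.3] -/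
theorem exists_mem_formalFiltration_two_padicLog_eq {y : ℚ_[p]} (hy : ‖y‖ ≤ ((p : ℝ)⁻¹) ^ 2) :
    ∃ Q ∈ X.formalFiltration 2, padicLog X Q = y := by
  obtain ⟨Q, hQ, hLQ⟩ := X.exists_mem_padicLimitLog_eq le_rfl hy
  exact ⟨Q, hQ, by rw [padicLog_apply_of_mem X hQ, hLQ]⟩

/-- `E⁽²⁾ ⊆ E₁`. [folklore] -/
theorem formalFiltration_two_le_zero : X.formalFiltration 2 ≤ X.formalFiltration 0 :=
  X.formalFiltration_antitone (Nat.zero_le 2)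

end General

/-! ## §2 `p = 3`: `E₁(ℚ₃)` is torsion-free and `log(E₁(ℚ₃)) = 3ℤ₃` -/

section Three

variable (X : WeierstrassCurve ℚ_[p]) [X.IsIntegral ℤ_[p]] [X.IsElliptic]

/-- **`E₁(ℚ₃)[3] = 0`** in the `formalFiltration` currency (n1011-p13's
`LocalTorsionExp3.eq_zero_of_reducesToZero_of_three_nsmul` through the bridge
`kernelOfReduction = formalFiltration 0`). [cite: SilvermanAEC2009, VII.3.1 with IV.6.1] -/
theorem eq_zero_of_mem_formalFiltration_zero_of_p_nsmul (hp : p = 3) {P : X.toAffine.Point}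
    (hP : P ∈ X.formalFiltration 0) (h : p • P = 0) : P = 0 := by
  subst hp
  obtain ⟨I, hI⟩ : ∃ I : WeierstrassCurve ℤ_[3], X = I.baseChange ℚ_[3] :=
    IsIntegral.integral (R := ℤ_[3]) (W := X)
  subst hI
  rw [← kernelOfReduction_eq_formalFiltration_zero I, mem_kernelOfReduction_iff] at hP
  exact LocalTorsionExp3.eq_zero_of_reducesToZero_of_three_nsmul I hP h

/-- **`E₁(ℚ₃)` is torsion-free**: a torsion point `P ∈ E₁(ℚ₃)` has `3 • P ∈ E⁽²⁾(ℚ₃) ≅ 9ℤ₃`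
torsion, so `3 • P = 0`, so `P = 0`. [cite: SilvermanAEC2009, VII.3.1 and IV.6.4(b)] -/
theorem eq_zero_of_mem_formalFiltration_zero_of_isOfFinAddOrder (hp : p = 3) {P : X.toAffine.Point}
    (hP : P ∈ X.formalFiltration 0) (hfin : IsOfFinAddOrder P) : P = 0 := by
  have h2 := p_nsmul_mem_formalFiltration_two X hP
  have hlog0 : padicLog X P = 0 := (padicLog_eq_zero_iff X P).mpr hfin
  have hL : X.padicLimitLog (p • P) = 0 := by
    rw [← padicLog_apply_of_mem X h2, map_nsmul, hlog0, nsmul_zero]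
  exact eq_zero_of_mem_formalFiltration_zero_of_p_nsmul X hp hP
    (X.eq_zero_of_padicLimitLog_eq_zero le_rfl h2 hL)

/-- `log` is injective on `E₁(ℚ₃)` (its kernel is the torsion, and `E₁(ℚ₃)` is torsion-free).
[cite: SilvermanAEC2009, IV.6.4(b)] -/
theorem eq_of_mem_formalFiltration_zero_of_padicLog_eq (hp : p = 3) {P Q : X.toAffine.Point}
    (hP : P ∈ X.formalFiltration 0) (hQ : Q ∈ X.formalFiltration 0)
    (h : padicLog X P = padicLog X Q) : P = Q := by
  have hdiff : padicLog X (P - Q) = 0 := by rw [map_sub, h, sub_self]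
  exact sub_eq_zero.mp (eq_zero_of_mem_formalFiltration_zero_of_isOfFinAddOrder X hp
    (sub_mem hP hQ) ((padicLog_eq_zero_iff X _).mp hdiff))

/-- The point of `E₁(ℚ₃)` with parameter `z = 3` has `‖log‖ = 3⁻¹` EXACTLY (were it `≤ 3⁻²`, the
point would lie in `E⁽²⁾` by `E⁽²⁾ ≅ 9ℤ₃` and injectivity, contradicting `‖z‖ = 3⁻¹`).
[cite: SilvermanAEC2009, IV.6.4(b) with VII.2.2] -/
theorem exists_mem_formalFiltration_zero_norm_padicLog_eq (hp : p = 3) :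
    ∃ P ∈ X.formalFiltration 0, ‖padicLog X P‖ = (p : ℝ)⁻¹ := by
  have hp0 : (0 : ℝ) < p := by exact_mod_cast (Fact.out : p.Prime).pos
  obtain ⟨P₁, hk₁, hz₁⟩ := X.exists_formalParameter_eq_p_pow (le_refl 1)
  have hP₁ : P₁ ∈ X.formalFiltration 0 := (X.mem_formalFiltration_zero_iff).mpr hk₁
  refine ⟨P₁, hP₁, le_antisymm (norm_padicLog_le_inv_of_mem X hP₁) (not_lt.mp fun hlt => ?_)⟩
  have hle2 : ‖padicLog X P₁‖ ≤ ((p : ℝ)⁻¹) ^ 2 :=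
    (padicNorm_lt_inv_pow_iff_le _ 1).mp (by rwa [pow_one])
  obtain ⟨Q, hQ, hQy⟩ := exists_mem_formalFiltration_two_padicLog_eq X hle2
  have hPQ : P₁ = Q := eq_of_mem_formalFiltration_zero_of_padicLog_eq X hp hP₁
    (formalFiltration_two_le_zero X hQ) hQy.symm
  have hzQ := hQ.2
  rw [← hPQ, hz₁, pow_one, Padic.norm_p] at hzQ
  -- `p⁻¹ ≤ p⁻²` is absurd
  have hlt1 : (p : ℝ)⁻¹ < 1 := inv_lt_one_of_one_lt₀ (by exact_mod_cast (Fact.out : p.Prime).one_lt)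
  have : ((p : ℝ)⁻¹) ^ 2 < (p : ℝ)⁻¹ := by
    rw [pow_two]; exact mul_lt_of_lt_one_left (inv_pos.mpr hp0) hlt1
  exact absurd hzQ (not_le.mpr this)

/-- **`3ℤ₃ ⊆ log(E₁(ℚ₃))`**: every `y` with `‖y‖ ≤ 3⁻¹` is `log P` for some `P ∈ E₁(ℚ₃)`.  With `P₁`
of exact norm `‖log P₁‖ = 3⁻¹` and `u := y / log P₁ ∈ ℤ₃`, `m := u mod 3 ∈ {0,1,2}`:
`(u − m)·log P₁` has norm `≤ 3⁻²`, hence is `log Q` with `Q ∈ E⁽²⁾`, and `P := m • P₁ + Q` works.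
[cite: SilvermanAEC2009, IV.6.4(b) (`Ê(𝓜) ≅ 𝓜`)] -/
theorem exists_mem_formalFiltration_zero_padicLog_eq (hp : p = 3) {y : ℚ_[p]}
    (hy : ‖y‖ ≤ (p : ℝ)⁻¹) : ∃ P ∈ X.formalFiltration 0, padicLog X P = y := by
  have hp0 : (0 : ℝ) < p := by exact_mod_cast (Fact.out : p.Prime).pos
  obtain ⟨P₁, hP₁, hy₁⟩ := exists_mem_formalFiltration_zero_norm_padicLog_eq X hp
  set y₁ := padicLog X P₁ with hy₁def
  have hy₁0 : y₁ ≠ 0 := by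
    intro h; rw [h, norm_zero] at hy₁; exact (inv_pos.mpr hp0).ne hy₁
  have hu : ‖y / y₁‖ ≤ 1 := by
    rw [norm_div, hy₁]; exact (div_le_one (inv_pos.mpr hp0)).mpr hy
  set u : ℤ_[p] := ⟨y / y₁, hu⟩ with hudef
  -- `m = u mod p`
  have hum : ‖((u - (u.zmodRepr : ℤ_[p]) : ℤ_[p]) : ℚ_[p])‖ ≤ (p : ℝ)⁻¹ := by
    have hlt : ‖u - (u.zmodRepr : ℤ_[p])‖ < 1 :=
      PadicInt.mem_nonunits.mp ((IsLocalRing.mem_maximalIdeal _).mp (PadicInt.sub_zmodRepr_mem u))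
    rw [PadicInt.norm_def] at hlt
    have := (padicNorm_lt_inv_pow_iff_le ((u - (u.zmodRepr : ℤ_[p]) : ℤ_[p]) : ℚ_[p]) 0).mp
      (by rwa [pow_zero])
    rwa [pow_one] at this
  have hsmall : ‖(((u - (u.zmodRepr : ℤ_[p]) : ℤ_[p]) : ℚ_[p])) * y₁‖ ≤ ((p : ℝ)⁻¹) ^ 2 := by
    rw [norm_mul, hy₁, pow_two]
    exact mul_le_mul_of_nonneg_right hum (inv_nonneg.mpr hp0.le)
  obtain ⟨Q, hQ, hQy⟩ := exists_mem_formalFiltration_two_padicLog_eq X hsmall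
  refine ⟨u.zmodRepr • P₁ + Q, add_mem (AddSubgroup.nsmul_mem _ hP₁ _)
    (formalFiltration_two_le_zero X hQ), ?_⟩
  rw [map_add, map_nsmul, hQy, nsmul_eq_mul, PadicInt.coe_sub, PadicInt.coe_natCast]
  have hucoe : ((u : ℤ_[p]) : ℚ_[p]) = y / y₁ := rfl
  rw [hucoe]
  field_simp
  ring

/-- **`log(E₁(ℚ₃)) = 3ℤ₃`** as subgroups of `ℚ₃` (Lemma L (i): `log_ω E₁(ℚ₃) = 3ℤ₃`).
[cite: SilvermanAEC2009, IV.6.4(b) with VII.2.2] -/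
theorem map_padicLog_formalFiltration_zero (hp : p = 3) :
    (X.formalFiltration 0).map (padicLog X) =
      (Submodule.span ℤ_[p] {(p : ℚ_[p])}).toAddSubgroup := by
  have hp0 : (0 : ℝ) < p := by exact_mod_cast (Fact.out : p.Prime).pos
  have hpq : (p : ℚ_[p]) ≠ 0 := Nat.cast_ne_zero.mpr (Fact.out : p.Prime).ne_zero
  ext y
  rw [AddSubgroup.mem_map, Submodule.mem_toAddSubgroup, Submodule.mem_span_singleton]
  constructor
  · rintro ⟨P, hP, rfl⟩
    have h := norm_padicLog_le_inv_of_mem X hP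
    have hc : ‖padicLog X P / (p : ℚ_[p])‖ ≤ 1 := by
      rw [norm_div, Padic.norm_p]; exact (div_le_one (inv_pos.mpr hp0)).mpr h
    refine ⟨⟨padicLog X P / (p : ℚ_[p]), hc⟩, ?_⟩
    rw [Algebra.smul_def, PadicInt.algebraMap_apply]
    exact div_mul_cancel₀ _ hpq
  · rintro ⟨c, rfl⟩
    have hle : ‖(c • (p : ℚ_[p]))‖ ≤ (p : ℝ)⁻¹ := by
      rw [Algebra.smul_def, PadicInt.algebraMap_apply, norm_mul, Padic.norm_p]
      exact mul_le_of_le_one_left (inv_nonneg.mpr hp0.le) (PadicInt.norm_le_one c)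
    obtain ⟨P, hP, hPy⟩ := exists_mem_formalFiltration_zero_padicLog_eq X hp hle
    exact ⟨P, hP, hPy⟩

end Three

/-! ## §3 ADDITIVE reduction: `log(E₀) = log(E)`, `= ℤ_p` at `t = 0`, and the (δ) step of SAT₀ -/

section Additive

variable (X : WeierstrassCurve ℚ_[p]) [hadd : X.HasAdditiveReduction ℤ_[p]] [X.IsElliptic]

/-- **`log(E₀(ℚ_p)) = log(E(ℚ_p))` at an additive prime with `p ∤ c_p`** (any `p`): `c_p • P ∈ E₀`
for every `P`, and `log(E(ℚ_p)) = p^{t − v_p c_p}ℤ_p` is a `ℤ_p`-module on which the unit `c_p`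
acts invertibly. [cite: SilvermanAEC2009, VII.6.1 and VII.6.3] -/
theorem map_padicLog_goodReductionSubgroup_eq_range (hcp : ¬ p ∣ X.localTamagawaNumber ℤ_[p]) :
    (X.goodReductionSubgroup ℤ_[p]).map (padicLog X) = (padicLog X).range := by
  refine le_antisymm (AddSubgroup.map_le_range _ _) ?_
  rintro y ⟨P, rfl⟩
  set c := X.localTamagawaNumber ℤ_[p] with hcdef
  have hcidx : c = (X.goodReductionSubgroup ℤ_[p]).index :=
    localTamagawaNumber_eq_index_of_isMinimal X
  have hcu : IsUnit ((c : ℕ) : ℤ_[p]) := by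
    rw [PadicInt.isUnit_iff, PadicInt.norm_natCast_eq_one_iff]
    exact (Nat.Prime.coprime_iff_not_dvd Fact.out).mpr hcp
  obtain ⟨u, hu⟩ := hcu
  -- `u⁻¹ • log P` is again a value of `log`
  have hy' : ((u⁻¹ : ℤ_[p]ˣ) : ℤ_[p]) • padicLog X P ∈ (padicLog X).range := by
    have hy : padicLog X P ∈ (padicLog X).range := ⟨P, rfl⟩
    rw [range_padicLog_eq_span_zpow_of_hasAdditiveReduction] at hy ⊢
    exact (Submodule.span ℤ_[p] _).smul_mem _ hy
  obtain ⟨P', hP'⟩ := hy'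
  refine ⟨c • P', ?_, ?_⟩
  · rw [hcidx]; exact AddSubgroup.nsmul_index_mem _ _
  · rw [map_nsmul, hP', nsmul_eq_mul, Algebra.smul_def, PadicInt.algebraMap_apply, ← mul_assoc,
      ← PadicInt.coe_natCast, ← PadicInt.coe_mul, ← hu, Units.mul_inv, PadicInt.coe_one, one_mul]

/-- **`log(E(ℚ_p)) = ℤ_p` at an additive prime with `p ∤ c_p` and `E(ℚ_p)[p] = 0`** (n1011's
`range_padicLog_eq_span_pow_of_hasAdditiveReduction_of_not_dvd` at `t = 0`; the hypothesis
`E(ℚ_p)[p] = 0` is read as "no point of order `p`", Cauchy). [cite: Kim2022StructureSelmer, Lemma 3.10 (PDF p. 17)] -/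
theorem range_padicLog_eq_span_one (hcp : ¬ p ∣ X.localTamagawaNumber ℤ_[p])
    (ht : ∀ P : X.toAffine.Point, p • P = 0 → P = 0) :
    (padicLog X).range = (Submodule.span ℤ_[p] {(1 : ℚ_[p])}).toAddSubgroup := by
  rw [range_padicLog_eq_span_pow_of_hasAdditiveReduction_of_not_dvd X hcp]
  have h0 : padicValNat p (Nat.card (AddCommGroup.torsion X.toAffine.Point)) = 0 := by
    apply padicValNat.eq_zero_of_not_dvd
    intro hdvd
    haveI := finite_torsion_point X
    obtain ⟨T, hT⟩ := exists_prime_addOrderOf_dvd_card' (G := AddCommGroup.torsion X.toAffine.Point)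
      p hdvd
    have hpT' : p • T = 0 := by
      have h := addOrderOf_nsmul_eq_zero T
      rwa [hT] at h
    have hpT : p • (T : X.toAffine.Point) = 0 := by
      have h := congrArg Subtype.val hpT'
      simpa only [AddSubgroupClass.coe_nsmul, ZeroMemClass.coe_zero] using h
    have hT0 : T = 0 := Subtype.ext (ht _ hpT)
    rw [hT0, addOrderOf_zero] at hT
    exact (Fact.out : p.Prime).one_lt.ne hT
  rw [h0, pow_zero]

/-- **`log(E₀(ℚ_p)) = ℤ_p`** under the same hypotheses (Lemma L (i) / SAT₀ (δ): `log_ω E₀(ℚ₃) = ℤ₃`).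
[cite: Kim2022StructureSelmer, Lemma 3.10 (PDF p. 17)] -/
theorem map_padicLog_goodReductionSubgroup_eq_span_one (hcp : ¬ p ∣ X.localTamagawaNumber ℤ_[p])
    (ht : ∀ P : X.toAffine.Point, p • P = 0 → P = 0) :
    (X.goodReductionSubgroup ℤ_[p]).map (padicLog X) =
      (Submodule.span ℤ_[p] {(1 : ℚ_[p])}).toAddSubgroup := by
  rw [map_padicLog_goodReductionSubgroup_eq_range X hcp, range_padicLog_eq_span_one X hcp ht]

/-- `E₁ ⊆ E₀` in the currencies `formalFiltration 0 ≤ goodReductionSubgroup`. [cite: SilvermanAEC2009, VII.2 Prop. 2.1] -/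
theorem formalFiltration_zero_le_goodReductionSubgroup :
    X.formalFiltration 0 ≤ X.goodReductionSubgroup ℤ_[p] := by
  obtain ⟨I, hI⟩ : ∃ I : WeierstrassCurve ℤ_[p], X = I.baseChange ℚ_[p] :=
    IsIntegral.integral (R := ℤ_[p]) (W := X)
  subst hI
  rw [goodReductionSubgroup_baseChange_eq, ← kernelOfReduction_eq_formalFiltration_zero I]
  exact kernelOfReduction_le_nonsingularReductionSubgroup _

/-- **`3 • E₀(ℚ₃) ⊆ E₁(ℚ₃)` at ADDITIVE reduction** in the `formalFiltration` currency (n1011-p13's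
`LocalTorsionExp3.reducesToZero_three_nsmul_of_mem`: the reduction is a cusp, `Ẽ_ns ≅ 𝔾_a` is
killed by `3`). [cite: SilvermanAEC2009, VII.2 Prop. 2.1 and III.2.5] -/
theorem p_nsmul_mem_formalFiltration_zero_of_mem_goodReductionSubgroup (hp : p = 3)
    {P : X.toAffine.Point} (hP : P ∈ X.goodReductionSubgroup ℤ_[p]) :
    p • P ∈ X.formalFiltration 0 := by
  subst hp
  obtain ⟨I, hI⟩ : ∃ I : WeierstrassCurve ℤ_[3], X = I.baseChange ℚ_[3] :=
    IsIntegral.integral (R := ℤ_[3]) (W := X)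
  subst hI
  have hΔm : I.Δ ∈ maximalIdeal ℤ_[3] := by
    have h := hadd.badReduction
    rw [WeierstrassCurve.baseChange, WeierstrassCurve.map_Δ] at h
    exact (IsDedekindDomain.HeightOneSpectrum.valuation_lt_one_iff_mem _ _).mp h
  have hc₄m : I.c₄ ∈ maximalIdeal ℤ_[3] := by
    have h := hadd.additiveReduction
    rw [WeierstrassCurve.baseChange, WeierstrassCurve.map_c₄] at h
    exact (IsDedekindDomain.HeightOneSpectrum.valuation_lt_one_iff_mem _ _).mp h
  have hΔ : residue ℤ_[3] I.Δ = 0 := (residue_eq_zero_iff _).mpr hΔm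
  have hc₄ : residue ℤ_[3] I.c₄ = 0 := (residue_eq_zero_iff _).mpr hc₄m
  rw [goodReductionSubgroup_baseChange_eq] at hP
  rw [← kernelOfReduction_eq_formalFiltration_zero I, mem_kernelOfReduction_iff]
  exact LocalTorsionExp3.reducesToZero_three_nsmul_of_mem I hΔ hc₄ hP

/-- **SAT₀'s step (δ) at `p = 3`, `t = 0`: a point of `E₀(ℚ₃)` whose logarithm lies in `3ℤ₃` lies
in `E₁(ℚ₃)`** — i.e. `λ_{ℚ₃} = log_ω mod 3 : E₀(ℚ₃)/E₁(ℚ₃) → ℤ₃/3ℤ₃` is injective.  Proof: pick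
`Q ∈ E₁` with `log Q = log P` (§2); `T = P − Q ∈ E₀` is torsion, `3 • T ∈ E₁` is torsion hence `0`,
so `T ∈ E(ℚ₃)[3] = 0`.  No hypothesis on `c₃`. [cite: Kim2022StructureSelmer, §3.3 (Lemma 3.11, first line)] -/
theorem mem_formalFiltration_zero_of_norm_padicLog_le (hp : p = 3)
    (ht : ∀ P : X.toAffine.Point, p • P = 0 → P = 0) {P : X.toAffine.Point}
    (hP0 : P ∈ X.goodReductionSubgroup ℤ_[p]) (hlog : ‖padicLog X P‖ ≤ (p : ℝ)⁻¹) :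
    P ∈ X.formalFiltration 0 := by
  obtain ⟨Q, hQ, hQy⟩ := exists_mem_formalFiltration_zero_padicLog_eq X hp hlog
  have hT0 : P - Q ∈ X.goodReductionSubgroup ℤ_[p] :=
    sub_mem hP0 (formalFiltration_zero_le_goodReductionSubgroup X hQ)
  have hlogT : padicLog X (P - Q) = 0 := by rw [map_sub, hQy, sub_self]
  have hfin : IsOfFinAddOrder (P - Q) := (padicLog_eq_zero_iff X _).mp hlogT
  have h3T : p • (P - Q) ∈ X.formalFiltration 0 :=
    p_nsmul_mem_formalFiltration_zero_of_mem_goodReductionSubgroup X hp hT0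
  have h3T0 : p • (P - Q) = 0 :=
    eq_zero_of_mem_formalFiltration_zero_of_isOfFinAddOrder X hp h3T hfin.nsmul
  have hT : P - Q = 0 := ht _ h3T0
  rw [sub_eq_zero] at hT
  rw [hT]; exact hQ

omit hadd [X.IsElliptic] in
/-- The crux's local-torsion binder `#{Q : E(ℚ₃) // 3 • Q = 0} = 1` in the form used above.
[folklore] -/
theorem forall_p_nsmul_eq_zero_of_natCard_eq_one
    (h : Nat.card {Q : X.toAffine.Point // p • Q = 0} = 1) :
    ∀ P : X.toAffine.Point, p • P = 0 → P = 0 := by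
  intro P hP
  haveI : Subsingleton {Q : X.toAffine.Point // p • Q = 0} :=
    (Nat.card_eq_one_iff_unique.mp h).1
  have := Subsingleton.elim (⟨P, hP⟩ : {Q : X.toAffine.Point // p • Q = 0})
    ⟨0, by rw [nsmul_zero]⟩
  exact congrArg Subtype.val this

end Additive

end Summit.BirchSwinnertonDyer.BirchSwinnertonDyer.Theorems.KimAtThreeFineKatoSATPoints

end
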